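import Literature.NumberTheory.Transcendental.KZIdealTetrahedron
import Literature.NumberTheory.Transcendental.KZLogCalculusProofs
import Summits.KontsevichZagierPeriods.KontsevichZagierPeriods.Theorems.FiveTermTransfer.Negative.Inversion

/-!
# `FiveTermTransfer` (stmt-KontsevichZagierPeriods-3469) — line `valuation-kernel-sweep`,
stub `stub_inversionMove`

Upper half-space model of `ℍ³`, points `p = (p 0, p 1, p 2)` with height `t = p 2 > 0`. For
`u v : ℂ`, `L u v p > 0` says that `(p 0, p 1)` lies to the left of the directed line `u → v`; for
`u v w : ℂ`, `S u v w p` is the `4 × 4` determinant with rows `(|p|², p 0, p 1, 1)`,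
`(|u|², Re u, Im u, 1)`, `(|v|², …)`, `(|w|², …)`, whose zero set is the hemisphere through
`u, v, w`. The prism `P u v w` is the open solid over the open triangle `(u, v, w)` above that
hemisphere, and the finite ideal tetrahedron with ideal vertices `0, 1, x, y` is cut out by the four
face hemispheres ("same side as the opposite vertex").

**The move.** The unit inversion `ι p = p / |p|²` (Poincaré extension of `u ↦ 1/ū`; it fixes `1`,
sends `∞ ↦ 0`, `1/x̄ ↦ x`, `1/ȳ ↦ y`) maps the prism `P 1 (1/x̄) (1/ȳ)` onto the tetrahedron
`(0, 1, x, y)`: the four sign conditions correspond one to one through eight exact algebraic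
identities (`idq_*`, `idc_*` below; e.g. `S 0 1 x (ι p) · |p|² = |x|² · L 1 (1/x̄) p` and
`S 0 1 x (Re y, Im y, 0) = |x|² |y|² · L 1 (1/x̄) (1/ȳ)`), each with a manifestly positive factor.
Since `|det Dι| = |p|⁻⁶` and `t⁻³ = (t/|p|²)⁻³ · |p|⁻⁶`, a representation with integrand `t⁻³`
on the prism and the one with integrand `t⁻³` on the tetrahedron differ by ONE
change-of-variables generator of the Kontsevich–Zagier calculus. The inversion machinery
(`inv3`, `inv3'`, `hasFDerivAt_inv3`, `abs_det_inv3'`, `isSemialgebraicMapOn_inv3`, `injOn_inv3`,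
`inv3_inv3`) is the tree's `Theorems/FiveTermTransfer/Negative/Inversion.lean`; semialgebraicity
of the tetrahedron is obtained as the image of the (semialgebraic) prism under the semialgebraic
map `ι` (`IsSemialgebraicMapOn.isSemialgebraic_image_holds`, Tarski–Seidenberg), and
integrability of `t⁻³` on it from Mathlib's
`MeasureTheory.integrableOn_image_iff_integrableOn_abs_det_fderiv_smul`. [folklore]
-/

noncomputable section

open MeasureTheory Set Complex
open scoped ComplexConjugate

namespace Summit.KontsevichZagierPeriods.HyperbolicBloch.FiveTerm

open Literature.NumberTheory.Transcendental
open Literature.NumberTheory.Transcendental.KZ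
open Literature.ModelTheory.ExponentialFields (IsSemialgebraic)
open Summit.KontsevichZagierPeriods.HyperbolicBloch.FiveTermTransferNegative

/-! ### Elementary facts on `1/x̄ = (conj x)⁻¹` -/

/-- Real part of `1/x̄`: `Re x / |x|²`. [folklore] -/
private theorem cinv_re (x : ℂ) : ((conj x)⁻¹).re = x.re / Complex.normSq x := by
  simp [Complex.inv_re]

/-- Imaginary part of `1/x̄`: `Im x / |x|²`. [folklore] -/
private theorem cinv_im (x : ℂ) : ((conj x)⁻¹).im = x.im / Complex.normSq x := by
  simp [Complex.inv_im]

/-- `|x|² = (Re x)² + (Im x)²`. [folklore] -/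
private theorem normSq_eq_sq (x : ℂ) : Complex.normSq x = x.re ^ 2 + x.im ^ 2 := by
  rw [Complex.normSq_apply]; ring

/-- `(Re x)² + (Im x)² ≠ 0` for `x ≠ 0`. [folklore] -/
private theorem sq_add_sq_ne_zero {x : ℂ} (hx : x ≠ 0) : x.re ^ 2 + x.im ^ 2 ≠ 0 := by
  rw [← normSq_eq_sq]; exact (Complex.normSq_pos.mpr hx).ne'

/-! ### The eight identities relating the faces of the tetrahedron and of the prism -/

section Identities

variable (L : ℂ → ℂ → (Fin 3 → ℝ) → ℝ)
  (hL : ∀ u v p, L u v p = (v.re - u.re) * (p 1 - u.im) - (v.im - u.im) * (p 0 - u.re))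
  (S : ℂ → ℂ → ℂ → (Fin 3 → ℝ) → ℝ)
  (hS : ∀ u v w p, S u v w p = (p 0 ^ 2 + p 1 ^ 2 + p 2 ^ 2) * (u.re * (v.im - w.im) -
    u.im * (v.re - w.re) + (v.re * w.im - v.im * w.re)) - p 0 * (Complex.normSq u * (v.im - w.im) -
    u.im * (Complex.normSq v - Complex.normSq w) + (Complex.normSq v * w.im -
    v.im * Complex.normSq w)) + p 1 * (Complex.normSq u * (v.re - w.re) -
    u.re * (Complex.normSq v - Complex.normSq w) + (Complex.normSq v * w.re -
    v.re * Complex.normSq w)) - (Complex.normSq u * (v.re * w.im - v.im * w.re) -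
    u.re * (Complex.normSq v * w.im - v.im * Complex.normSq w) +
    u.im * (Complex.normSq v * w.re - v.re * Complex.normSq w)))

include hL hS

/-- Face `01x` of the tetrahedron at `ι p` ↔ vertical face `1 (1/x̄)` of the prism at `p`:
`S 0 1 x (ι p) · |p|² = |x|² · L 1 (1/x̄) p`. [folklore] -/
private theorem idq_S01x {x : ℂ} (hx : x ≠ 0) {p : Fin 3 → ℝ} (hs : sqn p ≠ 0) :
    S 0 1 x (inv3 p) * sqn p = Complex.normSq x * L 1 (conj x)⁻¹ p := by
  have hN := sq_add_sq_ne_zero hx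
  simp only [hS, hL, inv3_apply, cinv_re, cinv_im, zero_re, zero_im, one_re, one_im,
    map_zero, map_one, normSq_eq_sq]
  unfold sqn at hs ⊢
  field_simp
  ring

/-- The constant of face `01x`: `S 0 1 x (y, 0) = |x|² |y|² · L 1 (1/x̄) (1/ȳ, 0)`. [folklore] -/
private theorem idc_S01x {x y : ℂ} (hx : x ≠ 0) (hy : y ≠ 0) :
    S 0 1 x ![y.re, y.im, 0] = Complex.normSq x * Complex.normSq y *
      L 1 (conj x)⁻¹ ![((conj y)⁻¹).re, ((conj y)⁻¹).im, 0] := by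
  have hN := sq_add_sq_ne_zero hx
  have hM := sq_add_sq_ne_zero hy
  simp only [hS, hL, cinv_re, cinv_im, zero_re, zero_im, one_re, one_im,
    map_zero, map_one, Matrix.cons_val_zero, Matrix.cons_val_one, Matrix.head_cons,
    Matrix.cons_val_two, Matrix.tail_cons, normSq_eq_sq]
  field_simp
  ring

/-- Face `01y` of the tetrahedron at `ι p` ↔ vertical face `(1/ȳ) 1` of the prism at `p`:
`S 0 1 y (ι p) · |p|² = -|y|² · L (1/ȳ) 1 p`. [folklore] -/
private theorem idq_S01y {y : ℂ} (hy : y ≠ 0) {p : Fin 3 → ℝ} (hs : sqn p ≠ 0) :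
    S 0 1 y (inv3 p) * sqn p = -Complex.normSq y * L (conj y)⁻¹ 1 p := by
  have hM := sq_add_sq_ne_zero hy
  simp only [hS, hL, inv3_apply, cinv_re, cinv_im, zero_re, zero_im, one_re, one_im,
    map_zero, map_one, normSq_eq_sq]
  unfold sqn at hs ⊢
  field_simp
  ring

/-- The constant of face `01y`: `S 0 1 y (x, 0) = -|x|² |y|² · L 1 (1/x̄) (1/ȳ, 0)`. [folklore] -/
private theorem idc_S01y {x y : ℂ} (hx : x ≠ 0) (hy : y ≠ 0) :
    S 0 1 y ![x.re, x.im, 0] = -(Complex.normSq x * Complex.normSq y) *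
      L 1 (conj x)⁻¹ ![((conj y)⁻¹).re, ((conj y)⁻¹).im, 0] := by
  have hN := sq_add_sq_ne_zero hx
  have hM := sq_add_sq_ne_zero hy
  simp only [hS, hL, cinv_re, cinv_im, zero_re, zero_im, one_re, one_im,
    map_zero, map_one, Matrix.cons_val_zero, Matrix.cons_val_one, Matrix.head_cons,
    Matrix.cons_val_two, Matrix.tail_cons, normSq_eq_sq]
  field_simp
  ring

/-- Face `0xy` of the tetrahedron at `ι p` ↔ vertical face `(1/x̄) (1/ȳ)` of the prism at `p`:
`S 0 x y (ι p) · |p|² = |x|² |y|² · L (1/x̄) (1/ȳ) p`. [folklore] -/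
private theorem idq_S0xy {x y : ℂ} (hx : x ≠ 0) (hy : y ≠ 0) {p : Fin 3 → ℝ} (hs : sqn p ≠ 0) :
    S 0 x y (inv3 p) * sqn p =
      Complex.normSq x * Complex.normSq y * L (conj x)⁻¹ (conj y)⁻¹ p := by
  have hN := sq_add_sq_ne_zero hx
  have hM := sq_add_sq_ne_zero hy
  simp only [hS, hL, inv3_apply, cinv_re, cinv_im, zero_re, zero_im, map_zero, normSq_eq_sq]
  unfold sqn at hs ⊢
  field_simp
  ring

/-- The constant of face `0xy`: `S 0 x y (1, 0, 0) = |x|² |y|² · L 1 (1/x̄) (1/ȳ, 0)`. [folklore] -/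
private theorem idc_S0xy {x y : ℂ} (hx : x ≠ 0) (hy : y ≠ 0) :
    S 0 x y ![1, 0, 0] = Complex.normSq x * Complex.normSq y *
      L 1 (conj x)⁻¹ ![((conj y)⁻¹).re, ((conj y)⁻¹).im, 0] := by
  have hN := sq_add_sq_ne_zero hx
  have hM := sq_add_sq_ne_zero hy
  simp only [hS, hL, cinv_re, cinv_im, zero_re, zero_im, one_re, one_im,
    map_zero, Matrix.cons_val_zero, Matrix.cons_val_one, Matrix.head_cons,
    Matrix.cons_val_two, Matrix.tail_cons, normSq_eq_sq]
  field_simp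
  ring

omit hL in
/-- Face `1xy` of the tetrahedron at `ι p` ↔ the hemisphere `1 (1/x̄) (1/ȳ)` of the prism at `p`:
`S 1 x y (ι p) · |p|² = -|x|² |y|² · S 1 (1/x̄) (1/ȳ) p`. [folklore] -/
private theorem idq_S1xy {x y : ℂ} (hx : x ≠ 0) (hy : y ≠ 0) {p : Fin 3 → ℝ} (hs : sqn p ≠ 0) :
    S 1 x y (inv3 p) * sqn p =
      -(Complex.normSq x * Complex.normSq y) * S 1 (conj x)⁻¹ (conj y)⁻¹ p := by
  have hN := sq_add_sq_ne_zero hx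
  have hM := sq_add_sq_ne_zero hy
  simp only [hS, inv3_apply, cinv_re, cinv_im, one_re, one_im, map_one, normSq_eq_sq]
  unfold sqn at hs ⊢
  field_simp
  ring

/-- The constant of face `1xy`: `S 1 x y (0, 0, 0) = -|x|² |y|² · L 1 (1/x̄) (1/ȳ, 0)`.
[folklore] -/
private theorem idc_S1xy {x y : ℂ} (hx : x ≠ 0) (hy : y ≠ 0) :
    S 1 x y ![0, 0, 0] = -(Complex.normSq x * Complex.normSq y) *
      L 1 (conj x)⁻¹ ![((conj y)⁻¹).re, ((conj y)⁻¹).im, 0] := by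
  have hN := sq_add_sq_ne_zero hx
  have hM := sq_add_sq_ne_zero hy
  simp only [hS, hL, cinv_re, cinv_im, one_re, one_im,
    map_one, Matrix.cons_val_zero, Matrix.cons_val_one, Matrix.head_cons,
    Matrix.cons_val_two, Matrix.tail_cons, normSq_eq_sq]
  field_simp
  ring

/-- **The prism and the tetrahedron correspond under `ι`.** For `p` in the upper half space, `p`
satisfies the five sign conditions of the prism `P 1 (1/x̄) (1/ȳ)` iff `ι p` satisfies the five
sign conditions of the finite ideal tetrahedron `(0, 1, x, y)` (each tetrahedron product at `ι p`
is a positive multiple `|x|^{2i} |y|^{2j} / |p|²` of the corresponding prism product at `p`).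
[folklore] -/
theorem memPrism_iff_inv3_memTet {x y : ℂ} (hx : x ≠ 0) (hy : y ≠ 0) {p : Fin 3 → ℝ}
    (hp : 0 < p 2) :
    (0 < p 2 ∧ 0 < L 1 (conj x)⁻¹ ![((conj y)⁻¹).re, ((conj y)⁻¹).im, 0] * L 1 (conj x)⁻¹ p ∧
      0 < L 1 (conj x)⁻¹ ![((conj y)⁻¹).re, ((conj y)⁻¹).im, 0] * L (conj x)⁻¹ (conj y)⁻¹ p ∧
      0 < L 1 (conj x)⁻¹ ![((conj y)⁻¹).re, ((conj y)⁻¹).im, 0] * L (conj y)⁻¹ 1 p ∧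
      0 < L 1 (conj x)⁻¹ ![((conj y)⁻¹).re, ((conj y)⁻¹).im, 0] *
        S 1 (conj x)⁻¹ (conj y)⁻¹ p) ↔
    (0 < inv3 p 2 ∧ 0 < S 1 x y (inv3 p) * S 1 x y ![0, 0, 0] ∧
      0 < S 0 x y (inv3 p) * S 0 x y ![1, 0, 0] ∧
      0 < S 0 1 y (inv3 p) * S 0 1 y ![x.re, x.im, 0] ∧
      0 < S 0 1 x (inv3 p) * S 0 1 x ![y.re, y.im, 0]) := by
  set J := L 1 (conj x)⁻¹ ![((conj y)⁻¹).re, ((conj y)⁻¹).im, 0] with hJ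
  have hs : 0 < sqn p := sqn_pos hp
  have hN : 0 < Complex.normSq x := Complex.normSq_pos.mpr hx
  have hM : 0 < Complex.normSq y := Complex.normSq_pos.mpr hy
  have q5 := eq_div_of_mul_eq hs.ne' (idq_S01x L hL S hS hx (p := p) hs.ne')
  have q4 := eq_div_of_mul_eq hs.ne' (idq_S01y L hL S hS hy (p := p) hs.ne')
  have q3 := eq_div_of_mul_eq hs.ne' (idq_S0xy L hL S hS hx hy (p := p) hs.ne')
  have q2 := eq_div_of_mul_eq hs.ne' (idq_S1xy S hS hx hy (p := p) hs.ne')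
  have e5 : S 0 1 x (inv3 p) * S 0 1 x ![y.re, y.im, 0] =
      Complex.normSq x ^ 2 * Complex.normSq y / sqn p * (J * L 1 (conj x)⁻¹ p) := by
    rw [q5, idc_S01x L hL S hS hx hy, ← hJ]; ring
  have e4 : S 0 1 y (inv3 p) * S 0 1 y ![x.re, x.im, 0] =
      Complex.normSq x * Complex.normSq y ^ 2 / sqn p * (J * L (conj y)⁻¹ 1 p) := by
    rw [q4, idc_S01y L hL S hS hx hy, ← hJ]; ring
  have e3 : S 0 x y (inv3 p) * S 0 x y ![1, 0, 0] =
      (Complex.normSq x * Complex.normSq y) ^ 2 / sqn p * (J * L (conj x)⁻¹ (conj y)⁻¹ p) := by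
    rw [q3, idc_S0xy L hL S hS hx hy, ← hJ]; ring
  have e2 : S 1 x y (inv3 p) * S 1 x y ![0, 0, 0] =
      (Complex.normSq x * Complex.normSq y) ^ 2 / sqn p * (J * S 1 (conj x)⁻¹ (conj y)⁻¹ p) := by
    rw [q2, idc_S1xy L hL S hS hx hy, ← hJ]; ring
  have c2 : 0 < (Complex.normSq x * Complex.normSq y) ^ 2 / sqn p :=
    div_pos (pow_pos (mul_pos hN hM) 2) hs
  have c4 : 0 < Complex.normSq x * Complex.normSq y ^ 2 / sqn p :=
    div_pos (mul_pos hN (pow_pos hM 2)) hs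
  have c5 : 0 < Complex.normSq x ^ 2 * Complex.normSq y / sqn p :=
    div_pos (mul_pos (pow_pos hN 2) hM) hs
  rw [e2, e3, e4, e5, inv3_apply]
  constructor
  · rintro ⟨h1, h2, h3, h4, h5⟩
    exact ⟨div_pos h1 hs, (mul_pos_iff_of_pos_left c2).2 h5, (mul_pos_iff_of_pos_left c2).2 h3,
      (mul_pos_iff_of_pos_left c4).2 h4, (mul_pos_iff_of_pos_left c5).2 h2⟩
  · rintro ⟨-, h2, h3, h4, h5⟩
    exact ⟨hp, (mul_pos_iff_of_pos_left c5).1 h5, (mul_pos_iff_of_pos_left c2).1 h3,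
      (mul_pos_iff_of_pos_left c4).1 h4, (mul_pos_iff_of_pos_left c2).1 h2⟩

end Identities

/-! ### The stub -/

/-- **Inversion move.** The unit inversion `p ↦ p / |p|²` (Poincaré extension of `u ↦ 1/ū`, a
`ℚ`-rational map with `|det| = |p|⁻⁶` absorbed by `t⁻³`) carries any representation with integrand
`t⁻³` on the prism over the triangle `(1, 1/x̄, 1/ȳ)` to one on the finite ideal tetrahedron
`(0, 1, x, y)` (the three vertical faces go to the hemispheres through `0`, the hemisphere to the
hemisphere through `1, x, y`): ONE change-of-variables move. [folklore] -/
theorem stub_inversionMove :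
    ∀ (L : ℂ → ℂ → (Fin 3 → ℝ) → ℝ),
      (∀ u v p, L u v p = (v.re - u.re) * (p 1 - u.im) - (v.im - u.im) * (p 0 - u.re)) →
    ∀ (S : ℂ → ℂ → ℂ → (Fin 3 → ℝ) → ℝ),
      (∀ u v w p, S u v w p = (p 0 ^ 2 + p 1 ^ 2 + p 2 ^ 2) * (u.re * (v.im - w.im) -
        u.im * (v.re - w.re) + (v.re * w.im - v.im * w.re)) -
        p 0 * (Complex.normSq u * (v.im - w.im) - u.im * (Complex.normSq v - Complex.normSq w) +
          (Complex.normSq v * w.im - v.im * Complex.normSq w)) +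
        p 1 * (Complex.normSq u * (v.re - w.re) - u.re * (Complex.normSq v - Complex.normSq w) +
          (Complex.normSq v * w.re - v.re * Complex.normSq w)) -
        (Complex.normSq u * (v.re * w.im - v.im * w.re) -
          u.re * (Complex.normSq v * w.im - v.im * Complex.normSq w) +
          u.im * (Complex.normSq v * w.re - v.re * Complex.normSq w))) →
    ∀ (P : ℂ → ℂ → ℂ → Set (Fin 3 → ℝ)),
      (∀ u v w, P u v w = {p | 0 < p 2 ∧ 0 < L u v ![w.re, w.im, 0] * L u v p ∧
        0 < L u v ![w.re, w.im, 0] * L v w p ∧ 0 < L u v ![w.re, w.im, 0] * L w u p ∧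
        0 < L u v ![w.re, w.im, 0] * S u v w p}) →
    ∀ (x y : ℂ), IsAlgebraic ℚ x → IsAlgebraic ℚ y → x ≠ 0 → x ≠ 1 → y ≠ 0 → y ≠ 1 → x ≠ y →
    ∀ (R : KZ.IntegralRep 3), R.domain = P 1 ((starRingEnd ℂ) x)⁻¹ ((starRingEnd ℂ) y)⁻¹ →
      Set.EqOn R.integrand (fun p => 1 / p 2 ^ 3) R.domain →
      ∃ R' : KZ.IntegralRep 3,
        R'.domain = {q : Fin 3 → ℝ | 0 < q 2 ∧ 0 < S 1 x y q * S 1 x y ![0, 0, 0] ∧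
          0 < S 0 x y q * S 0 x y ![1, 0, 0] ∧ 0 < S 0 1 y q * S 0 1 y ![x.re, x.im, 0] ∧
          0 < S 0 1 x q * S 0 1 x ![y.re, y.im, 0]} ∧
        Set.EqOn R'.integrand (fun p => 1 / p 2 ^ 3) R'.domain ∧
        KZ.of R - KZ.of R' ∈ KZ.relations := by
  intro L hL S hS P hP x y _ _ hx0 _ hy0 _ _ R hRd hRi
  -- heights are positive on the prism
  have hpos : R.domain ⊆ {p | 0 < p 2} := by
    intro p hp
    rw [hRd, hP] at hp
    exact hp.1
  have hsq : ∀ p ∈ R.domain, sqn p ≠ 0 := fun p hp => (sqn_pos (hpos hp)).ne'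
  -- the data of the change-of-variables move
  have hsa : IsSemialgebraicMapOn ℚ R.domain inv3 :=
    isSemialgebraicMapOn_inv3 R.isSemialgebraic_domain hpos
  have hder : ∀ p ∈ R.domain, HasFDerivWithinAt inv3 (inv3' p) R.domain p :=
    fun p hp => (hasFDerivAt_inv3 (hsq p hp)).hasFDerivWithinAt
  have hinj : InjOn inv3 R.domain := injOn_inv3 hsq
  have hmeas : MeasurableSet R.domain := IntegralRep.measurableSet_domain_holds R
  -- the Jacobian is absorbed by `t⁻³`
  have hjac : ∀ p ∈ R.domain, R.integrand p = 1 / (inv3 p 2) ^ 3 * |(inv3' p).det| := by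
    intro p hp
    have hs : 0 < sqn p := sqn_pos (hpos hp)
    have ht : 0 < p 2 := hpos hp
    rw [hRi hp, inv3_apply, abs_det_inv3' hs]
    field_simp
  -- the image is semialgebraic (Tarski–Seidenberg), lies in the upper half space, and carries
  -- an integrable `t⁻³`
  have hσ' : IsSemialgebraic ℚ (inv3 '' R.domain) :=
    IsSemialgebraicMapOn.isSemialgebraic_image_holds hsa subset_rfl R.isSemialgebraic_domain
  have hpos' : inv3 '' R.domain ⊆ {q | 0 < q 2} := by
    rintro _ ⟨p, hp, rfl⟩
    show 0 < inv3 p 2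
    rw [inv3_apply]
    exact div_pos (hpos hp) (sqn_pos (hpos hp))
  have hint : IntegrableOn (fun q : Fin 3 → ℝ => 1 / q 2 ^ 3) (inv3 '' R.domain) := by
    rw [integrableOn_image_iff_integrableOn_abs_det_fderiv_smul volume hmeas hder hinj]
    refine R.integrableOn.congr_fun (fun p hp => ?_) hmeas
    simp only [smul_eq_mul]
    rw [hjac p hp]
    exact mul_comm _ _
  let R' : IntegralRep 3 := ⟨inv3 '' R.domain, fun q => 1 / q 2 ^ 3, hσ',
    isSemialgebraicFunOn_one_div_cube hσ' hpos', hint⟩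
  refine ⟨R', ?_, fun _ _ => rfl, changeOfVariablesRel_subset_relations
    ⟨3, R, R', inv3, inv3', hsa, hder, hinj, rfl, hjac, rfl⟩⟩
  -- the image of the prism is the tetrahedron
  show inv3 '' R.domain = _
  rw [hRd, hP]
  apply Subset.antisymm
  · rintro _ ⟨p, hp, rfl⟩
    exact (memPrism_iff_inv3_memTet L hL S hS hx0 hy0 hp.1).1 hp
  · intro q hq
    have hq2 : 0 < q 2 := hq.1
    have hsq' : sqn q ≠ 0 := (sqn_pos hq2).ne'
    refine ⟨inv3 q, ?_, inv3_inv3 hsq'⟩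
    have h2 : 0 < inv3 q 2 := by
      rw [inv3_apply]
      exact div_pos hq2 (sqn_pos hq2)
    apply (memPrism_iff_inv3_memTet L hL S hS hx0 hy0 h2).2
    rw [inv3_inv3 hsq']
    exact hq

end Summit.KontsevichZagierPeriods.HyperbolicBloch.FiveTerm

end
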